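import Literature.NumberTheory.QuadraticFields.ThreeTorsionMeanProofs
import HarnessLib

/-!
# BTT p. 3: "Theorem 1.2 is equivalent to (3)" — the 3-torsion sum versus the count of cubic fields of fundamental discriminant (proofs)

A `…Proofs` companion (theorems only: no definition, no named fact, no instance; D-0026) of
`Literature.NumberTheory.QuadraticFields.ThreeTorsionMean` (`btt_threeTorsion_sum`,
Bhargava–Taniguchi–Thorne 2023, Thm 1.2), continuing `ThreeTorsionMeanProofs.lean` (the PROVED
quadratic-field counts `#{0 < ±D < X fundamental} = (3/π²) X + O(√X)`).

Bhargava–Taniguchi–Thorne, p. 3: "Theorem 1.2 may be viewed as a counting theorem for cubic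
fields whose discriminant is fundamental. Indeed, as subgroups of `Cl(ℚ(√D))` of index `3` are in
bijection with cubic fields of discriminant `D` (see, e.g. [BST]), Theorem 1.2 is equivalent to
(3): `N^±_{3,fund}(X) = (C^±/(2π²)) X + K^± (4ζ(1/3)/(5Γ(2/3)³)) Π_p(…) X^{5/6} + O(X^{2/3+ε})`."
The bijection is class field theory (Hasse 1930) and is not in the tree; its finite-group half
`#Cl₃(D) = 2·#{index-3 subgroups} + 1` is PROVED in `ThreeTorsionProofs.lean`
(`quadFieldThreeTorsion_eq_two_mul_card_index_three_add_one`). This file PROVES the remaining,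
elementary content of the quoted equivalence, for an ABSTRACT count `c : ℤ → ℕ` subject only to
the dictionary `#Cl₃(D) = 2·c(D) + 1` (in print `c(D)` = the number of isomorphism classes of
cubic fields of discriminant `D`):

* `two_term_sum_iff_of_eq_two_mul_add_one` — abstract bookkeeping: `Σ t = 2 Σ c + #S X` and
  `#S X = d X + O(√X)` make the two-term asymptotic for `Σ t` (main term `m X`) equivalent to the
  one for `Σ c` (main term `((m − d)/2) X`), errors `O_ε(X^{2/3+ε})`, secondary terms existential;
* `btt_threeTorsion_sum_neg_iff_cubicCount`, `btt_threeTorsion_sum_pos_iff_cubicCount` — each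
  half of `btt_threeTorsion_sum` is equivalent to
  `Σ_{0<±D<X} c(D) = (C^±/(2π²)) X + K X^{5/6} + O_ε(X^{2/3+ε})` with `C⁻ = 3`, `C⁺ = 1`
  (so the vendored main terms `6/π²`, `4/π²` match the printed (3): `(6/π² − 3/π²)/2 = 3/(2π²)`,
  `(4/π² − 3/π²)/2 = 1/(2π²)`).

## References

* M. Bhargava, T. Taniguchi, F. Thorne, *Improved error estimates for the Davenport–Heilbronn
  theorems*, Math. Ann. 389 (2024) = arXiv:2107.12819, Thm 1.2 and display (3), p. 3
  [BhargavaTaniguchiThorne2023].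
* H. Hasse, *Arithmetische Theorie der kubischen Zahlkörper auf klassenkörpertheoretischer
  Grundlage*, Math. Z. 31 (1930) [Hasse1930].
-/

noncomputable section

open Finset Filter
open scoped Topology

namespace Literature.NumberTheory.QuadraticFields

/-! ### BTT p. 3: Thm 1.2 versus the count of cubic fields of fundamental discriminant -/

/-- **Abstract form of the equivalence "Theorem 1.2 ⟺ (3)" of Bhargava–Taniguchi–Thorne, p. 3.**
If a statistic `t` and a count `c` satisfy the dictionary `t(D) = 2·c(D) + 1` on the finsets
`S X`, and `#S X = d·X + O(√X)` (here with the constant `8` of `abs_card_posFundDiscrs_sub_le` /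
`abs_card_negFundDiscrs_sub_le`), then the two-term asymptotic
`Σ_{D ∈ S X} t(D) = m X + K X^{5/6} + O_ε(X^{2/3+ε})` (some `K`) holds iff
`Σ_{D ∈ S X} c(D) = ((m − d)/2) X + K' X^{5/6} + O_ε(X^{2/3+ε})` (some `K'`): indeed
`Σ t = 2 Σ c + #S X` and `√X ≤ X^{2/3+ε}` for `X ≥ 1`. [folklore] -/
theorem two_term_sum_iff_of_eq_two_mul_add_one {S : ℕ → Finset ℤ} {t c : ℤ → ℕ} {m d : ℝ}
    (htc : ∀ X : ℕ, ∀ D ∈ S X, t D = 2 * c D + 1)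
    (hS : ∀ X : ℕ, |((S X).card : ℝ) - d * X| ≤ 8 * Real.sqrt X) :
    (∃ K : ℝ, ∀ ε : ℝ, 0 < ε → ∃ C : ℝ, ∀ X : ℕ, 1 ≤ X →
      |(∑ D ∈ S X, (t D : ℝ)) - m * X - K * (X : ℝ) ^ ((5 : ℝ) / 6)|
        ≤ C * (X : ℝ) ^ ((2 : ℝ) / 3 + ε)) ↔
    (∃ K : ℝ, ∀ ε : ℝ, 0 < ε → ∃ C : ℝ, ∀ X : ℕ, 1 ≤ X →
      |(∑ D ∈ S X, (c D : ℝ)) - (m - d) / 2 * X - K * (X : ℝ) ^ ((5 : ℝ) / 6)|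
        ≤ C * (X : ℝ) ^ ((2 : ℝ) / 3 + ε)) := by
  -- `Σ t = 2 Σ c + #S`
  have hsum : ∀ X : ℕ, (∑ D ∈ S X, (t D : ℝ)) = 2 * (∑ D ∈ S X, (c D : ℝ)) + ((S X).card : ℝ) := by
    intro X
    rw [Finset.card_eq_sum_ones, Nat.cast_sum, Finset.mul_sum, ← Finset.sum_add_distrib]
    refine Finset.sum_congr rfl fun D hD => ?_
    rw [htc X D hD]
    push_cast
    ring
  -- `8 √X ≤ 8 X^{2/3+ε}` for `X ≥ 1`
  have hsqrt : ∀ {ε : ℝ}, 0 < ε → ∀ X : ℕ, 1 ≤ X →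
      8 * Real.sqrt X ≤ 8 * (X : ℝ) ^ ((2 : ℝ) / 3 + ε) := by
    intro ε hε X hX
    have hX1 : (1 : ℝ) ≤ X := by exact_mod_cast hX
    rw [Real.sqrt_eq_rpow]
    exact mul_le_mul_of_nonneg_left
      (Real.rpow_le_rpow_of_exponent_le hX1 (by linarith)) (by norm_num)
  constructor
  · rintro ⟨K, hK⟩
    refine ⟨K / 2, fun ε hε => ?_⟩
    obtain ⟨C, hC⟩ := hK ε hε
    refine ⟨(C + 8) / 2, fun X hX => ?_⟩
    have h1 := hC X hX
    have h2 := hS X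
    have h3 := hsqrt hε X hX
    rw [hsum X] at h1
    have key : (∑ D ∈ S X, (c D : ℝ)) - (m - d) / 2 * X - K / 2 * (X : ℝ) ^ ((5 : ℝ) / 6)
        = ((2 * (∑ D ∈ S X, (c D : ℝ)) + ((S X).card : ℝ) - m * X - K * (X : ℝ) ^ ((5 : ℝ) / 6))
          - (((S X).card : ℝ) - d * X)) / 2 := by ring
    rw [key, abs_div, abs_two]
    have h4 := abs_sub _ _ |>.trans (add_le_add h1 (h2.trans h3))
    rw [div_le_iff₀ (by norm_num : (0 : ℝ) < 2)]
    linarith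
  · rintro ⟨K, hK⟩
    refine ⟨2 * K, fun ε hε => ?_⟩
    obtain ⟨C, hC⟩ := hK ε hε
    refine ⟨2 * C + 8, fun X hX => ?_⟩
    have h1 := hC X hX
    have h2 := hS X
    have h3 := hsqrt hε X hX
    rw [hsum X]
    set E := (∑ D ∈ S X, (c D : ℝ)) - (m - d) / 2 * X - K * (X : ℝ) ^ ((5 : ℝ) / 6) with hE
    set F := ((S X).card : ℝ) - d * X with hF
    have key : 2 * (∑ D ∈ S X, (c D : ℝ)) + ((S X).card : ℝ) - m * X
        - 2 * K * (X : ℝ) ^ ((5 : ℝ) / 6) = 2 * E + F := by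
      simp only [hE, hF]
      ring
    rw [key]
    calc |2 * E + F| ≤ |2 * E| + |F| := abs_add_le _ _
      _ = 2 * |E| + |F| := by rw [abs_mul, abs_two]
      _ ≤ 2 * (C * (X : ℝ) ^ ((2 : ℝ) / 3 + ε)) + 8 * (X : ℝ) ^ ((2 : ℝ) / 3 + ε) :=
          add_le_add (by linarith) (h2.trans h3)
      _ = (2 * C + 8) * (X : ℝ) ^ ((2 : ℝ) / 3 + ε) := by ring

/-- **BTT p. 3, imaginary quadratic fields.** Let `c : ℤ → ℕ` be any function satisfying the
dictionary `#Cl₃(D) = 2·c(D) + 1` on negative fundamental discriminants (in print `c(D)` = the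
number of isomorphism classes of cubic fields of discriminant `D`, by the class-field-theoretic
bijection with index-`3` subgroups of `Cl(ℚ(√D))`, Hasse; with `ThreeTorsionProofs`'
`quadFieldThreeTorsion_eq_two_mul_card_index_three_add_one` the group-theoretic half of that
dictionary is proved). Then the imaginary half of Thm 1.2 (`btt_threeTorsion_sum`, main term
`(6/π²) X`) is EQUIVALENT to the printed count (3):
`N⁻_{3,fund}(X) = Σ_{-X<D<0} c(D) = (C⁻/(2π²)) X + K X^{5/6} + O_ε(X^{2/3+ε})` with `C⁻ = 3`
(secondary coefficient existential), by the PROVED `N₂⁻(X) = (3/π²) X + O(√X)`.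
[cite: BhargavaTaniguchiThorne2023, p. 3 (equivalence of Thm 1.2 with (3))] -/
theorem btt_threeTorsion_sum_neg_iff_cubicCount {c : ℤ → ℕ}
    (hc : ∀ X : ℕ, ∀ D ∈ negFundDiscrs X, quadFieldThreeTorsion D = 2 * c D + 1) :
    (∃ K : ℝ, ∀ ε : ℝ, 0 < ε → ∃ C : ℝ, ∀ X : ℕ, 1 ≤ X →
      |(∑ D ∈ negFundDiscrs X, (quadFieldThreeTorsion D : ℝ)) - 6 / Real.pi ^ 2 * X
          - K * (X : ℝ) ^ ((5 : ℝ) / 6)| ≤ C * (X : ℝ) ^ ((2 : ℝ) / 3 + ε)) ↔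
    (∃ K : ℝ, ∀ ε : ℝ, 0 < ε → ∃ C : ℝ, ∀ X : ℕ, 1 ≤ X →
      |(∑ D ∈ negFundDiscrs X, (c D : ℝ)) - 3 / (2 * Real.pi ^ 2) * X
          - K * (X : ℝ) ^ ((5 : ℝ) / 6)| ≤ C * (X : ℝ) ^ ((2 : ℝ) / 3 + ε)) := by
  have h := two_term_sum_iff_of_eq_two_mul_add_one (m := 6 / Real.pi ^ 2) hc
    abs_card_negFundDiscrs_sub_le
  have hpi : Real.pi ^ 2 ≠ 0 := pow_ne_zero 2 Real.pi_ne_zero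
  rwa [show (6 / Real.pi ^ 2 - 3 / Real.pi ^ 2) / 2 = 3 / (2 * Real.pi ^ 2) by
    field_simp; norm_num] at h

/-- **BTT p. 3, real quadratic fields.** With `c` as in `btt_threeTorsion_sum_neg_iff_cubicCount`
on positive fundamental discriminants, the real half of Thm 1.2 (main term `(4/π²) X`) is
EQUIVALENT to `N⁺_{3,fund}(X) = Σ_{0<D<X} c(D) = (C⁺/(2π²)) X + K X^{5/6} + O_ε(X^{2/3+ε})` with
`C⁺ = 1`. [cite: BhargavaTaniguchiThorne2023, p. 3 (equivalence of Thm 1.2 with (3))] -/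
theorem btt_threeTorsion_sum_pos_iff_cubicCount {c : ℤ → ℕ}
    (hc : ∀ X : ℕ, ∀ D ∈ posFundDiscrs X, quadFieldThreeTorsion D = 2 * c D + 1) :
    (∃ K : ℝ, ∀ ε : ℝ, 0 < ε → ∃ C : ℝ, ∀ X : ℕ, 1 ≤ X →
      |(∑ D ∈ posFundDiscrs X, (quadFieldThreeTorsion D : ℝ)) - 4 / Real.pi ^ 2 * X
          - K * (X : ℝ) ^ ((5 : ℝ) / 6)| ≤ C * (X : ℝ) ^ ((2 : ℝ) / 3 + ε)) ↔
    (∃ K : ℝ, ∀ ε : ℝ, 0 < ε → ∃ C : ℝ, ∀ X : ℕ, 1 ≤ X →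
      |(∑ D ∈ posFundDiscrs X, (c D : ℝ)) - 1 / (2 * Real.pi ^ 2) * X
          - K * (X : ℝ) ^ ((5 : ℝ) / 6)| ≤ C * (X : ℝ) ^ ((2 : ℝ) / 3 + ε)) := by
  have h := two_term_sum_iff_of_eq_two_mul_add_one (m := 4 / Real.pi ^ 2) hc
    abs_card_posFundDiscrs_sub_le
  have hpi : Real.pi ^ 2 ≠ 0 := pow_ne_zero 2 Real.pi_ne_zero
  rwa [show (4 / Real.pi ^ 2 - 3 / Real.pi ^ 2) / 2 = 1 / (2 * Real.pi ^ 2) by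
    field_simp; norm_num] at h

end Literature.NumberTheory.QuadraticFields

end
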